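import Summits.ResolutionOfSingularities.ResolutionOfSingularities.Theorems.EquisingularLiftEquisingularLiftNatSpecimenCuspConeAlgebra
import Summits.ResolutionOfSingularities.ResolutionOfSingularities.Theorems.EquisingularLiftEquisingularLiftNatSpecimenQuarticDerivations
import Mathlib.RingTheory.Nullstellensatz
import Mathlib.Algebra.MvPolynomial.PDeriv
import HarnessLib

/-!
# [OURS · EL♮(3)] SURFACES IN `ℙ³` WITH A LINE OF SUBMAXIMAL MULTIPLICITY — THE ALGEBRA: binary-form bookkeeping, the regularity engine
# `K[y]/(y_i q₁ + y_{i'} q₂ + q₃)`, and Hu's substitution on binary forms (crux `Theses.EquisingularLift.EquisingularLiftNatThree`,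
# stmt-ResolutionOfSingularities-20148; parent EL♮ stmt-…-20038)

[OURS · leafhand-res-equisingularlift-7 g0, 2026-08-31; cell `pub/decomp-res`] AI-produced, weaker than expert review; NOT a statement of any
manuscript; nothing here proves resolution of singularities in positive characteristic.  DEF-FREE helper (`--supports stmt-…-20148`); no `sorry`;
standard axioms; ZERO named hypotheses.  Companion `…NatSubmaxLine` assembles the certificates for the family
`F = x₀·A(x₂,x₃) + x₁·B(x₂,x₃) + C(x₂,x₃)` (surfaces of degree `d + 2` with the line `V(x₂,x₃)` of multiplicity `d + 1`).

* `aeval_smul_of_isHomogeneous` — `G(u • q) = u^m · G(q)`; `pderiv_aeval_eq_zero`, `aeval_aeval_point`;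
* `eq_zero_of_aeval_dehomog₁/₂_eq_zero` — dehomogenisation `G ↦ G(1, t)` / `G(s, 1)` is injective on binary forms (`K` infinite);
* **`isRegularRing_quotient_lin`** — `K[y₀,y₁,y₂]/(y_i·q₁ + y_{i'}·q₂ + q₃)` is a regular ring when `∂_{y_i}, ∂_{y_{i'}}` kill `q₁, q₂, q₃` and
  `q₁, q₂, q₃` have no common zero in `K³`, `K = K̄` (Stacks 07PF in the tree's form `SpecimenQuartic.isRegularRing_quotient_of_derivations` +
  Mathlib's Nullstellensatz `MvPolynomial.isMaximal_iff_eq_vanishingIdeal_singleton`);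
* `no_common_zero_aeval`, `pderiv_aeval_dehomog₁/₂/₃` — feeding the engine from "`A, B, C` have no common zero on `ℙ¹`";
* `not_X_one_dvd`, `not_X_two_dvd` — the strict transforms `y₀·P(1,y₂) + y₁·r + Q(1,y₂)` (resp. `y₂`-chart) are not divisible by the exceptional
  variable when `(P, Q) ≠ (0, 0)`;
* `subst_aeval`, `subst₁_g`, `subst₂_g` — Hu's substitution (`coordBlowupSubst`, centre `CuspCone.cenVars = {y₁, y₂}`) on a binary form in the
  centre variables: `G(y₁,y₂) ↦ y₁^m·G(1,y₂)` / `y₂^m·G(y₁,1)`.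

References: The Stacks Project 07PF; Hu 2025 §5 Prop. 5.3; Görtz–Wedhorn (13.19) — through the cited tree files.
-/

set_option linter.dupNamespace false -- mandated namespace `Summit.<Summit>.<Problem>` of this single-conjunct summit

noncomputable section

open MvPolynomial
open Literature.AlgebraicGeometry.Resolution

namespace Summit.ResolutionOfSingularities.ResolutionOfSingularities.Cruxes.EquisingularLiftNat.Sections

namespace SubmaxLine

variable (K : Type) [Field K]

/-! ## Binary-form bookkeeping -/

/-- `G(u • q) = u ^ m · G(q)` for a form `G` of degree `m`, evaluated in any commutative `K`-algebra. [folklore] -/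
theorem aeval_smul_of_isHomogeneous {σ S : Type*} [CommRing S] [Algebra K S] {G : MvPolynomial σ K} {m : ℕ}
    (hG : G.IsHomogeneous m) (u : S) (q : σ → S) :
    aeval (u • q) G = u ^ m * aeval q G := by
  classical
  conv_lhs => rw [G.as_sum, map_sum]
  conv_rhs => rw [G.as_sum, map_sum, Finset.mul_sum]
  refine Finset.sum_congr rfl fun e he => ?_
  rw [aeval_monomial, aeval_monomial]
  have hdeg : m = ∑ i ∈ e.support, e i := hG.degree_eq_sum_deg_support he
  simp only [Pi.smul_apply, smul_eq_mul, mul_pow]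
  rw [Finsupp.prod_mul, hdeg, ← Finset.prod_pow_eq_pow_sum, Finsupp.prod, Finsupp.prod]
  ring

/-- A partial derivative kills `G(g₁, …, g_r)` as soon as it kills every `g_j`. [folklore] -/
theorem pderiv_aeval_eq_zero {σ τ : Type*} (l : τ) (g : σ → MvPolynomial τ K)
    (hg : ∀ j, pderiv l (g j) = 0) (G : MvPolynomial σ K) : pderiv l (aeval g G) = 0 := by
  induction G using MvPolynomial.induction_on with
  | C a => rw [aeval_C, MvPolynomial.algebraMap_eq]; exact pderiv_C
  | add p q hp hq => rw [map_add, map_add, hp, hq, add_zero]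
  | mul_X p j hp => rw [map_mul, aeval_X, Derivation.leibniz, hp, hg j, smul_zero, smul_zero, add_zero]

/-- Evaluating `G(g₁, g₂)` at a point `x` evaluates `G` at `(g₁(x), g₂(x))`. [folklore] -/
theorem aeval_aeval_point {σ τ : Type*} (x : τ → K) (g : σ → MvPolynomial τ K) (G : MvPolynomial σ K) :
    aeval x (aeval g G) = aeval (fun j => aeval x (g j)) G :=
  comp_aeval_apply g (aeval x) G

/-- **Dehomogenisation is injective on binary forms, first variable**: `G(1, t) = 0 ⟹ G = 0` (`G · s` vanishes at every point of `K²`,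
`K` infinite). [folklore] -/
theorem eq_zero_of_aeval_dehomog₁_eq_zero [Infinite K] (G : MvPolynomial (Fin 2) K) {m : ℕ} (hG : G.IsHomogeneous m)
    (h : aeval (![1, X 2] : Fin 2 → MvPolynomial (Fin 3) K) G = 0) : G = 0 := by
  have hGX : (G * X 0).IsHomogeneous (m + 1) := hG.mul (isHomogeneous_X K 0)
  have hzero : G * X 0 = 0 := by
    refine hGX.eq_zero_of_forall_eval_eq_zero fun r => ?_
    rw [map_mul, eval_X]
    by_cases hr : r 0 = 0
    · rw [hr, mul_zero]
    · have hr' : r = r 0 • (![1, r 1 / r 0] : Fin 2 → K) := by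
        funext j
        fin_cases j
        · simp
        · simp [mul_div_cancel₀ _ hr]
      have h1 : eval r G = r 0 ^ m * eval (![1, r 1 / r 0] : Fin 2 → K) G := by
        conv_lhs => rw [hr']
        rw [← coe_aeval_eq_eval, ← coe_aeval_eq_eval]
        exact aeval_smul_of_isHomogeneous K hG (r 0) _
      have h2 : eval (![1, r 1 / r 0] : Fin 2 → K) G = 0 := by
        have h3 := congrArg (aeval (![0, 0, r 1 / r 0] : Fin 3 → K)) h
        rw [aeval_aeval_point, map_zero] at h3
        have h4 : (fun j => aeval (![0, 0, r 1 / r 0] : Fin 3 → K) ((![1, X 2] : Fin 2 → MvPolynomial (Fin 3) K) j)) =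
            (![1, r 1 / r 0] : Fin 2 → K) := by
          funext j
          fin_cases j <;> simp
        rw [h4] at h3
        rw [← coe_aeval_eq_eval]
        exact h3
      rw [h1, h2, mul_zero, zero_mul]
  exact (mul_eq_zero.mp hzero).resolve_right (X_ne_zero 0)

/-- **Dehomogenisation is injective on binary forms, second variable**: `G(s, 1) = 0 ⟹ G = 0`. [folklore] -/
theorem eq_zero_of_aeval_dehomog₂_eq_zero [Infinite K] (G : MvPolynomial (Fin 2) K) {m : ℕ} (hG : G.IsHomogeneous m)
    (h : aeval (![X 1, 1] : Fin 2 → MvPolynomial (Fin 3) K) G = 0) : G = 0 := by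
  have hGX : (G * X 1).IsHomogeneous (m + 1) := hG.mul (isHomogeneous_X K 1)
  have hzero : G * X 1 = 0 := by
    refine hGX.eq_zero_of_forall_eval_eq_zero fun r => ?_
    rw [map_mul, eval_X]
    by_cases hr : r 1 = 0
    · rw [hr, mul_zero]
    · have hr' : r = r 1 • (![r 0 / r 1, 1] : Fin 2 → K) := by
        funext j
        fin_cases j
        · simp [mul_div_cancel₀ _ hr]
        · simp
      have h1 : eval r G = r 1 ^ m * eval (![r 0 / r 1, 1] : Fin 2 → K) G := by
        conv_lhs => rw [hr']
        rw [← coe_aeval_eq_eval, ← coe_aeval_eq_eval]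
        exact aeval_smul_of_isHomogeneous K hG (r 1) _
      have h2 : eval (![r 0 / r 1, 1] : Fin 2 → K) G = 0 := by
        have h3 := congrArg (aeval (![0, r 0 / r 1, 0] : Fin 3 → K)) h
        rw [aeval_aeval_point, map_zero] at h3
        have h4 : (fun j => aeval (![0, r 0 / r 1, 0] : Fin 3 → K) ((![X 1, 1] : Fin 2 → MvPolynomial (Fin 3) K) j)) =
            (![r 0 / r 1, 1] : Fin 2 → K) := by
          funext j
          fin_cases j <;> simp
        rw [h4] at h3
        rw [← coe_aeval_eq_eval]
        exact h3
      rw [h1, h2, mul_zero, zero_mul]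
  exact (mul_eq_zero.mp hzero).resolve_right (X_ne_zero 1)

/-! ## The regularity engine: `K[y]/(y_i q₁ + y_{i'} q₂ + q₃)` with `q₁, q₂, q₃` without common zero -/

/-- **`K[y₀,y₁,y₂]/(y_i·q₁ + y_{i'}·q₂ + q₃)` is a regular ring** when `∂_{y_i}, ∂_{y_{i'}}` kill `q₁, q₂, q₃` and `q₁, q₂, q₃` have no common zero in
`K³` (`K` algebraically closed): at a prime `Q` containing the equation and both `∂_{y_i} = q₁`, `∂_{y_{i'}} = q₂` one gets `q₃ ∈ Q`, and a maximal
ideal above `Q` is a point (Nullstellensatz) — a common zero.  Stacks 07PF in the tree's form `isRegularRing_quotient_of_derivations`.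
[cite: StacksProject, Tag 07PF] -/
theorem isRegularRing_quotient_lin [IsAlgClosed K] (q₁ q₂ q₃ : MvPolynomial (Fin 3) K) (i i' : Fin 3) (hii' : i' ≠ i)
    (h₁ : pderiv i q₁ = 0) (h₂ : pderiv i q₂ = 0) (h₃ : pderiv i q₃ = 0)
    (h₁' : pderiv i' q₁ = 0) (h₂' : pderiv i' q₂ = 0) (h₃' : pderiv i' q₃ = 0)
    (hz : ∀ x : Fin 3 → K, ¬ (aeval x q₁ = 0 ∧ aeval x q₂ = 0 ∧ aeval x q₃ = 0)) :
    IsRegularRing (MvPolynomial (Fin 3) K ⧸ Ideal.span {X i * q₁ + X i' * q₂ + q₃}) := by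
  refine Summit.ResolutionOfSingularities.ResolutionOfSingularities.Theorems.EquisingularLift.SpecimenQuartic.isRegularRing_quotient_of_derivations
    (S₀ := K) (X i * q₁ + X i' * q₂ + q₃) fun Q hQ hP => ?_
  by_contra hcon
  push Not at hcon
  have hDi : (pderiv i : Derivation K (MvPolynomial (Fin 3) K) (MvPolynomial (Fin 3) K)) (X i * q₁ + X i' * q₂ + q₃) = q₁ := by
    rw [map_add, map_add, Derivation.leibniz, Derivation.leibniz, pderiv_X_self, pderiv_X_of_ne hii', h₁, h₂, h₃]
    simp
  have hDi' : (pderiv i' : Derivation K (MvPolynomial (Fin 3) K) (MvPolynomial (Fin 3) K)) (X i * q₁ + X i' * q₂ + q₃) = q₂ := by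
    rw [map_add, map_add, Derivation.leibniz, Derivation.leibniz, pderiv_X_self, pderiv_X_of_ne (Ne.symm hii'), h₁', h₂', h₃']
    simp
  have hq₁ : q₁ ∈ Q := by simpa [hDi] using hcon (pderiv i)
  have hq₂ : q₂ ∈ Q := by simpa [hDi'] using hcon (pderiv i')
  have hq₃ : q₃ ∈ Q := by
    have h : q₃ = (X i * q₁ + X i' * q₂ + q₃) - (X i * q₁ + X i' * q₂) := by ring
    rw [h]
    exact Q.sub_mem hP (Q.add_mem (Q.mul_mem_left _ hq₁) (Q.mul_mem_left _ hq₂))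
  obtain ⟨M, hM, hQM⟩ := Ideal.exists_le_maximal Q hQ.ne_top
  obtain ⟨x, hx⟩ := (MvPolynomial.isMaximal_iff_eq_vanishingIdeal_singleton (K := K)).mp hM
  have hev : ∀ q ∈ Q, aeval x q = 0 := fun q hq =>
    (MvPolynomial.mem_vanishingIdeal_singleton_iff x q).mp (hx ▸ hQM hq)
  exact hz x ⟨hev _ hq₁, hev _ hq₂, hev _ hq₃⟩

/-- From "`A, B, C` have no common zero on `ℙ¹`" to "`A(g), B(g), C(g)` have no common zero in `K³`" when one component of `g` is `1`. [folklore] -/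
theorem no_common_zero_aeval (A B C : MvPolynomial (Fin 2) K)
    (hnc : ∀ v : Fin 2 → K, v ≠ 0 → ¬ (MvPolynomial.eval v A = 0 ∧ MvPolynomial.eval v B = 0 ∧ MvPolynomial.eval v C = 0))
    (g : Fin 2 → MvPolynomial (Fin 3) K) (j₁ : Fin 2) (hg : g j₁ = 1) (x : Fin 3 → K) :
    ¬ (aeval x (aeval g A) = 0 ∧ aeval x (aeval g B) = 0 ∧ aeval x (aeval g C) = 0) := by
  rintro ⟨ha, hb, hc⟩
  rw [aeval_aeval_point] at ha hb hc
  have hv : (fun j => aeval x (g j)) ≠ 0 := by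
    intro h0
    have h1 := congrFun h0 j₁
    simp only [hg, map_one, Pi.zero_apply] at h1
    exact one_ne_zero h1
  refine hnc _ hv ⟨?_, ?_, ?_⟩
  · rw [← coe_aeval_eq_eval]; exact ha
  · rw [← coe_aeval_eq_eval]; exact hb
  · rw [← coe_aeval_eq_eval]; exact hc

/-- `∂_l` kills `G(g)` for `g = (1, y₂)`, `l ≠ 2`. [folklore] -/
theorem pderiv_aeval_dehomog₁ (l : Fin 3) (hl : (2 : Fin 3) ≠ l) (G : MvPolynomial (Fin 2) K) :
    pderiv l (aeval (![1, X 2] : Fin 2 → MvPolynomial (Fin 3) K) G) = 0 :=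
  pderiv_aeval_eq_zero K l _ (fun j => by fin_cases j <;> simp [pderiv_X_of_ne hl]) G

/-- `∂_l` kills `G(g)` for `g = (y₁, 1)`, `l ≠ 1`. [folklore] -/
theorem pderiv_aeval_dehomog₂ (l : Fin 3) (hl : (1 : Fin 3) ≠ l) (G : MvPolynomial (Fin 2) K) :
    pderiv l (aeval (![X 1, 1] : Fin 2 → MvPolynomial (Fin 3) K) G) = 0 :=
  pderiv_aeval_eq_zero K l _ (fun j => by fin_cases j <;> simp [pderiv_X_of_ne hl]) G

/-- `∂_l` kills `G(g)` for `g = (y₂, 1)`, `l ≠ 2`. [folklore] -/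
theorem pderiv_aeval_dehomog₃ (l : Fin 3) (hl : (2 : Fin 3) ≠ l) (G : MvPolynomial (Fin 2) K) :
    pderiv l (aeval (![X 2, 1] : Fin 2 → MvPolynomial (Fin 3) K) G) = 0 :=
  pderiv_aeval_eq_zero K l _ (fun j => by fin_cases j <;> simp [pderiv_X_of_ne hl]) G

/-- **The strict transform is not divisible by the exceptional variable (`y₁`-chart)**: `y₁ ∤ y₀·P(1,y₂) + y₁·r + Q(1,y₂)` as soon as
`(P, Q) ≠ (0, 0)` (kill `y₁`, differentiate in `y₀`, dehomogenisation is injective on forms). [folklore] -/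
theorem not_X_one_dvd [Infinite K] (P Q : MvPolynomial (Fin 2) K) {m m' : ℕ} (hP : P.IsHomogeneous m) (hQ : Q.IsHomogeneous m')
    (hPQ : P ≠ 0 ∨ Q ≠ 0) (r : MvPolynomial (Fin 3) K) :
    ¬ ((X 1 : MvPolynomial (Fin 3) K) ∣
      X 0 * aeval (![1, X 2] : Fin 2 → MvPolynomial (Fin 3) K) P + X 1 * r + aeval (![1, X 2] : Fin 2 → MvPolynomial (Fin 3) K) Q) := by
  rintro ⟨w, hw⟩
  let φ : MvPolynomial (Fin 3) K →ₐ[K] MvPolynomial (Fin 3) K := aeval ![X 0, 0, X 2]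
  have hφg : ∀ G : MvPolynomial (Fin 2) K,
      φ (aeval (![1, X 2] : Fin 2 → MvPolynomial (Fin 3) K) G) = aeval (![1, X 2] : Fin 2 → MvPolynomial (Fin 3) K) G := by
    intro G
    rw [comp_aeval_apply]
    have hfun : (fun i => φ ((![1, X 2] : Fin 2 → MvPolynomial (Fin 3) K) i)) = (![1, X 2] : Fin 2 → MvPolynomial (Fin 3) K) := by
      funext j
      fin_cases j <;> simp [φ]
    rw [hfun]
  have hφ0 : φ (X 0) = X 0 := by simp [φ]
  have hφ1 : φ (X 1) = 0 := by simp [φ]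
  have h := congrArg φ hw
  rw [map_add, map_add, map_mul, map_mul, map_mul, hφg, hφg, hφ0, hφ1, zero_mul, zero_mul, add_zero] at h
  -- `h : y₀·P(1,y₂) + Q(1,y₂) = 0`; differentiate in `y₀`
  have hP0 : aeval (![1, X 2] : Fin 2 → MvPolynomial (Fin 3) K) P = 0 := by
    have h' := congrArg (pderiv 0 : MvPolynomial (Fin 3) K → MvPolynomial (Fin 3) K) h
    rw [map_add, Derivation.leibniz, pderiv_X_self, pderiv_aeval_dehomog₁ K 0 (by decide) P,
      pderiv_aeval_dehomog₁ K 0 (by decide) Q, map_zero] at h'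
    simpa using h'
  have hQ0 : aeval (![1, X 2] : Fin 2 → MvPolynomial (Fin 3) K) Q = 0 := by
    rw [hP0, mul_zero, zero_add] at h
    exact h
  rcases hPQ with hP' | hQ'
  · exact hP' (eq_zero_of_aeval_dehomog₁_eq_zero K P hP hP0)
  · exact hQ' (eq_zero_of_aeval_dehomog₁_eq_zero K Q hQ hQ0)

/-- **The strict transform is not divisible by the exceptional variable (`y₂`-chart)**: `y₂ ∤ y₀·P(y₁,1) + y₂·r + Q(y₁,1)` as soon as
`(P, Q) ≠ (0, 0)`. [folklore] -/
theorem not_X_two_dvd [Infinite K] (P Q : MvPolynomial (Fin 2) K) {m m' : ℕ} (hP : P.IsHomogeneous m) (hQ : Q.IsHomogeneous m')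
    (hPQ : P ≠ 0 ∨ Q ≠ 0) (r : MvPolynomial (Fin 3) K) :
    ¬ ((X 2 : MvPolynomial (Fin 3) K) ∣
      X 0 * aeval (![X 1, 1] : Fin 2 → MvPolynomial (Fin 3) K) P + X 2 * r + aeval (![X 1, 1] : Fin 2 → MvPolynomial (Fin 3) K) Q) := by
  rintro ⟨w, hw⟩
  let φ : MvPolynomial (Fin 3) K →ₐ[K] MvPolynomial (Fin 3) K := aeval ![X 0, X 1, 0]
  have hφg : ∀ G : MvPolynomial (Fin 2) K,
      φ (aeval (![X 1, 1] : Fin 2 → MvPolynomial (Fin 3) K) G) = aeval (![X 1, 1] : Fin 2 → MvPolynomial (Fin 3) K) G := by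
    intro G
    rw [comp_aeval_apply]
    have hfun : (fun i => φ ((![X 1, 1] : Fin 2 → MvPolynomial (Fin 3) K) i)) = (![X 1, 1] : Fin 2 → MvPolynomial (Fin 3) K) := by
      funext j
      fin_cases j <;> simp [φ]
    rw [hfun]
  have hφ0 : φ (X 0) = X 0 := by simp [φ]
  have hφ2 : φ (X 2) = 0 := by simp [φ]
  have h := congrArg φ hw
  rw [map_add, map_add, map_mul, map_mul, map_mul, hφg, hφg, hφ0, hφ2, zero_mul, zero_mul, add_zero] at h
  have hP0 : aeval (![X 1, 1] : Fin 2 → MvPolynomial (Fin 3) K) P = 0 := by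
    have h' := congrArg (pderiv 0 : MvPolynomial (Fin 3) K → MvPolynomial (Fin 3) K) h
    rw [map_add, Derivation.leibniz, pderiv_X_self, pderiv_aeval_dehomog₂ K 0 (by decide) P,
      pderiv_aeval_dehomog₂ K 0 (by decide) Q, map_zero] at h'
    simpa using h'
  have hQ0 : aeval (![X 1, 1] : Fin 2 → MvPolynomial (Fin 3) K) Q = 0 := by
    rw [hP0, mul_zero, zero_add] at h
    exact h
  rcases hPQ with hP' | hQ'
  · exact hP' (eq_zero_of_aeval_dehomog₂_eq_zero K P hP hP0)
  · exact hQ' (eq_zero_of_aeval_dehomog₂_eq_zero K Q hQ hQ0)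

/-- **Hu's substitution on a binary form in the centre variables**: `G(g) ↦ u^m · G(g')` when `g_j ↦ u·g'_j`. [cite: Hu2025, §5 Prop. 5.3] -/
theorem subst_aeval (i₀ : Fin 3) (g g' : Fin 2 → MvPolynomial (Fin 3) K) (u : MvPolynomial (Fin 3) K)
    (hg : ∀ j, coordBlowupSubst K CuspCone.cenVars i₀ (g j) = u * g' j) (G : MvPolynomial (Fin 2) K) {m : ℕ}
    (hG : G.IsHomogeneous m) :
    coordBlowupSubst K CuspCone.cenVars i₀ (aeval g G) = u ^ m * aeval g' G := by
  rw [comp_aeval_apply]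
  have h : (fun j => coordBlowupSubst K CuspCone.cenVars i₀ (g j)) = u • g' := by
    funext j
    rw [hg j]
    rfl
  rw [h, aeval_smul_of_isHomogeneous K hG]

/-- The `y₁`-chart substitution on the centre variables: `(y₁, y₂) ↦ y₁ · (1, y₂)`. [folklore] -/
theorem subst₁_g : ∀ j : Fin 2, coordBlowupSubst K CuspCone.cenVars 1 ((![X 1, X 2] : Fin 2 → MvPolynomial (Fin 3) K) j) =
    X 1 * (![1, X 2] : Fin 2 → MvPolynomial (Fin 3) K) j := by
  obtain ⟨-, h1, h2⟩ := CuspCone.subst₁_X K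
  intro j
  fin_cases j
  · change coordBlowupSubst K CuspCone.cenVars 1 (X 1) = X 1 * 1
    rw [h1, mul_one]
  · exact h2

/-- The `y₂`-chart substitution on the centre variables: `(y₁, y₂) ↦ y₂ · (y₁, 1)`. [folklore] -/
theorem subst₂_g : ∀ j : Fin 2, coordBlowupSubst K CuspCone.cenVars 2 ((![X 1, X 2] : Fin 2 → MvPolynomial (Fin 3) K) j) =
    X 2 * (![X 1, 1] : Fin 2 → MvPolynomial (Fin 3) K) j := by
  obtain ⟨-, h1, h2⟩ := CuspCone.subst₂_X K
  intro j
  fin_cases j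
  · exact h1
  · change coordBlowupSubst K CuspCone.cenVars 2 (X 2) = X 2 * 1
    rw [h2, mul_one]

end SubmaxLine

end Summit.ResolutionOfSingularities.ResolutionOfSingularities.Cruxes.EquisingularLiftNat.Sections

end
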